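import Mathlib
import HarnessLib
import Summits.RiemannHypothesis.RiemannHypothesis.Theorems.EarlyAppointmentsRemainder0XiFarLogKernelBasics
import Summits.RiemannHypothesis.RiemannHypothesis.Theorems.EarlyAppointmentsRemainder0XiFarLogKernelSubstForm
import Summits.RiemannHypothesis.RiemannHypothesis.Theorems.EarlyAppointmentsRemainder0XiLogIntegrals
import Summits.RiemannHypothesis.RiemannHypothesis.Theorems.EarlyAppointmentsRemainder0XiUpperIntegralFTC

/-!
# Log Decomposition for Far Log-Kernel

Proves log_integral_decomposition and integrability lemmas.
Supports stmt-RiemannHypothesis-24730 (Remainder0Xi crux).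
-/

set_option linter.dupNamespace false
namespace Summit.RiemannHypothesis.RiemannHypothesis.Cruxes.Remainder0Xi.Rho2V2

open scoped BigOperators Topology Classical
open Real Complex MeasureTheory Set Filter

open Summit.RiemannHypothesis.RiemannHypothesis.Theorems.EarlyAppointmentsRemainder0Xi
open Summit.RiemannHypothesis.RiemannHypothesis.Theorems.EarlyAppointmentsRemainder0Xi.UpperIntegral

/-- Integrability of log v/(1-v²) on (0,1). -/
lemma integrableOn_log_div_Ioo :
    IntegrableOn (fun v : ℝ => Real.log v / (1 - v ^ 2)) (Ioo 0 1) volume := by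
  have h : IntegrableOn (fun v => -Real.log v / (1 - v ^ 2)) (Ioo (0 : ℝ) 1) := by
    rw [IntegrableOn]
    apply integrable_of_lintegral_ofReal_ne_top
    · exact (Real.measurable_log.neg).div (measurable_const.sub (measurable_id.pow_const 2))
    · rw [Literature.NumberTheory.Transcendental.lintegral_neg_log_div_one_sub_sq]
      exact ENNReal.ofReal_ne_top
    · have h0 : ∀ v ∈ Ioo (0 : ℝ) 1, 0 ≤ -Real.log v / (1 - v ^ 2) := fun v hv => by
        apply div_nonneg (neg_nonneg.2 (Real.log_nonpos hv.1.le hv.2.le))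
        have hsq : v ^ 2 < 1 := by nlinarith [hv.1, hv.2]
        linarith
      have hae : ∀ᵐ v ∂(volume.restrict (Ioo 0 1)), ENNReal.ofReal (-(-Real.log v / (1 - v ^ 2))) = 0 := by
        filter_upwards [ae_restrict_mem measurableSet_Ioo] with v hv
        rw [show -(-Real.log v / (1 - v ^ 2)) = Real.log v / (1 - v ^ 2) by ring, ENNReal.ofReal_eq_zero]
        apply div_nonpos_of_nonpos_of_nonneg (Real.log_nonpos hv.1.le hv.2.le)
        have hsq : v ^ 2 < 1 := by nlinarith [hv.1, hv.2]
        linarith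
      rw [lintegral_congr_ae hae, lintegral_zero]; exact ENNReal.zero_ne_top
  exact (show (fun v => Real.log v / (1 - v ^ 2)) = (fun v => -(-Real.log v / (1 - v ^ 2))) by ext v; ring) ▸ h.neg

/-- Integrability of log v/(1-v²) on (1,∞). -/
lemma integrableOn_log_div_Ioi :
    IntegrableOn (fun v : ℝ => Real.log v / (1 - v ^ 2)) (Ioi 1) volume := by
  have hint := integral_log_div_one_sub_sq_Ioi_eq_neg_pi_sq_div_8
  have hne : -π ^ 2 / 8 ≠ 0 := by have hpi : 0 < π := Real.pi_pos; nlinarith [sq_nonneg π]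
  exact Integrable.of_integral_ne_zero (hint ▸ hne)

/-- Log decomposition: ∫ log(xv/2π)/(1-v²) = ∫ log(v)/(1-v²) + log(x/2π) * ∫ 1/(1-v²). -/
lemma log_integral_decomposition {x : ℝ} (hx : T_PT / 2 < x) :
    (∫ v in Ioo (lowStart / x) (1 - boxHalfWidth / x), Real.log (x * v / (2 * Real.pi)) / (1 - v ^ 2)) +
    ∫ v in Ioi (1 + boxHalfWidth / x), Real.log (x * v / (2 * Real.pi)) / (1 - v ^ 2) =
    ((∫ v in Ioo (lowStart / x) (1 - boxHalfWidth / x), Real.log v / (1 - v ^ 2)) +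
     ∫ v in Ioi (1 + boxHalfWidth / x), Real.log v / (1 - v ^ 2)) +
    Real.log (x / (2 * Real.pi)) *
    ((∫ v in Ioo (lowStart / x) (1 - boxHalfWidth / x), 1 / (1 - v ^ 2)) +
     ∫ v in Ioi (1 + boxHalfWidth / x), 1 / (1 - v ^ 2)) := by
  have hx_pos := pos_of_T_PT_half_lt hx
  have hx_ne : x ≠ 0 := hx_pos.ne'
  have hε_pos : 0 < lowStart / x := div_pos (by norm_num : (0 : ℝ) < 14) hx_pos
  have hδ_pos : 0 < boxHalfWidth / x := div_pos (by norm_num [boxHalfWidth] : (0 : ℝ) < boxHalfWidth) hx_pos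
  have h2pi_pos : 0 < 2 * Real.pi := by positivity
  have hε : lowStart / x < 1 - boxHalfWidth / x := by linarith [lowStart_div_x_small hx, boxHalfWidth_div_x_small hx]
  have h1_plus_δ_gt_1 : 1 < 1 + boxHalfWidth / x := by linarith
  have h1_minus_δ_lt_1 : 1 - boxHalfWidth / x < 1 := by linarith

  have hlog_split : ∀ v : ℝ, 0 < v →
      Real.log (x * v / (2 * Real.pi)) = Real.log v + Real.log (x / (2 * Real.pi)) := by
    intro v hv
    rw [Real.log_div (mul_pos hx_pos hv).ne' h2pi_pos.ne', Real.log_mul hx_pos.ne' hv.ne',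
        Real.log_div hx_pos.ne' h2pi_pos.ne']; ring

  -- Integrability conditions
  have h_upper_le : 1 - boxHalfWidth / x ≤ 1 := by linarith
  have h_lower_ge : 1 ≤ 1 + boxHalfWidth / x := by linarith
  have hint_log_Ioo := integrableOn_log_div_Ioo.mono_set (Ioo_subset_Ioo hε_pos.le h_upper_le)
  have hint_log_Ioi := integrableOn_log_div_Ioi.mono_set (Ioi_subset_Ioi h_lower_ge)
  have hint_inv_Ioi := integrableOn_inv_one_sub_sq_Ioi h1_plus_δ_gt_1

  have hint_const_Ioi : IntegrableOn (fun v => Real.log (x / (2 * Real.pi)) / (1 - v ^ 2))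
      (Ioi (1 + boxHalfWidth / x)) := by
    have h := hint_inv_Ioi.const_mul (Real.log (x / (2 * Real.pi)))
    simp only [one_div] at h; refine h.congr ?_; filter_upwards with v; ring

  have hint_inv_Ioo : IntegrableOn (fun v => 1 / (1 - v ^ 2)) (Ioo (lowStart / x) (1 - boxHalfWidth / x)) := by
    have hcpt : IsCompact (Icc (lowStart / x) (1 - boxHalfWidth / x)) := isCompact_Icc
    apply (ContinuousOn.integrableOn_compact hcpt ?_).mono_set Ioo_subset_Icc_self
    apply ContinuousOn.div continuousOn_const (continuous_const.sub (continuous_pow 2)).continuousOn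
    intro v hv; have hv_lt_1 : v < 1 := lt_of_le_of_lt hv.2 h1_minus_δ_lt_1
    have h_sq_lt_1 : v ^ 2 < 1 := by
      have hv_abs : |v| < 1 := abs_lt.mpr ⟨by linarith [hε_pos, hv.1], hv_lt_1⟩
      calc v ^ 2 = |v| ^ 2 := (sq_abs v).symm
        _ < 1 ^ 2 := sq_lt_sq' (by linarith [abs_nonneg v]) hv_abs
        _ = 1 := one_pow 2
    have hne : 1 - v ^ 2 ≠ 0 := by linarith
    exact hne

  have hint_const_Ioo : IntegrableOn (fun v => Real.log (x / (2 * Real.pi)) / (1 - v ^ 2))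
      (Ioo (lowStart / x) (1 - boxHalfWidth / x)) := by
    have h := hint_inv_Ioo.const_mul (Real.log (x / (2 * Real.pi)))
    simp only [one_div] at h; refine h.congr ?_; filter_upwards with v; ring

  -- Rewrite integrands using log split
  have h_Ioo_rw : ∫ v in Ioo (lowStart / x) (1 - boxHalfWidth / x), Real.log (x * v / (2 * Real.pi)) / (1 - v ^ 2) =
      ∫ v in Ioo (lowStart / x) (1 - boxHalfWidth / x), (Real.log v + Real.log (x / (2 * Real.pi))) / (1 - v ^ 2) := by
    apply MeasureTheory.setIntegral_congr_fun measurableSet_Ioo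
    intro v hv; simp only [hlog_split v (hε_pos.trans hv.1)]

  have h_Ioi_rw : ∫ v in Ioi (1 + boxHalfWidth / x), Real.log (x * v / (2 * Real.pi)) / (1 - v ^ 2) =
      ∫ v in Ioi (1 + boxHalfWidth / x), (Real.log v + Real.log (x / (2 * Real.pi))) / (1 - v ^ 2) := by
    apply MeasureTheory.setIntegral_congr_fun measurableSet_Ioi
    intro v hv; simp only [hlog_split v (lt_trans (by linarith) hv)]

  rw [h_Ioo_rw, h_Ioi_rw]; simp_rw [add_div]

  have h_Ioo_add : ∫ v in Ioo (lowStart / x) (1 - boxHalfWidth / x),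
        (Real.log v / (1 - v ^ 2) + Real.log (x / (2 * Real.pi)) / (1 - v ^ 2)) =
      (∫ v in Ioo (lowStart / x) (1 - boxHalfWidth / x), Real.log v / (1 - v ^ 2)) +
      ∫ v in Ioo (lowStart / x) (1 - boxHalfWidth / x), Real.log (x / (2 * Real.pi)) / (1 - v ^ 2) :=
    integral_add hint_log_Ioo hint_const_Ioo

  have h_Ioi_add : ∫ v in Ioi (1 + boxHalfWidth / x),
        (Real.log v / (1 - v ^ 2) + Real.log (x / (2 * Real.pi)) / (1 - v ^ 2)) =
      (∫ v in Ioi (1 + boxHalfWidth / x), Real.log v / (1 - v ^ 2)) +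
      ∫ v in Ioi (1 + boxHalfWidth / x), Real.log (x / (2 * Real.pi)) / (1 - v ^ 2) :=
    integral_add hint_log_Ioi hint_const_Ioi

  have h_const_Ioo : ∫ v in Ioo (lowStart / x) (1 - boxHalfWidth / x), Real.log (x / (2 * Real.pi)) / (1 - v ^ 2) =
      Real.log (x / (2 * Real.pi)) * ∫ v in Ioo (lowStart / x) (1 - boxHalfWidth / x), 1 / (1 - v ^ 2) := by
    conv_lhs => arg 2; ext v; rw [show Real.log (x / (2 * Real.pi)) / (1 - v ^ 2) = Real.log (x / (2 * Real.pi)) * (1 / (1 - v ^ 2)) by ring]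
    rw [integral_const_mul]

  have h_const_Ioi : ∫ v in Ioi (1 + boxHalfWidth / x), Real.log (x / (2 * Real.pi)) / (1 - v ^ 2) =
      Real.log (x / (2 * Real.pi)) * ∫ v in Ioi (1 + boxHalfWidth / x), 1 / (1 - v ^ 2) := by
    conv_lhs => arg 2; ext v; rw [show Real.log (x / (2 * Real.pi)) / (1 - v ^ 2) = Real.log (x / (2 * Real.pi)) * (1 / (1 - v ^ 2)) by ring]
    rw [integral_const_mul]

  calc (∫ v in Ioo (lowStart / x) (1 - boxHalfWidth / x), (Real.log v / (1 - v ^ 2) + Real.log (x / (2 * Real.pi)) / (1 - v ^ 2))) +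
       ∫ v in Ioi (1 + boxHalfWidth / x), (Real.log v / (1 - v ^ 2) + Real.log (x / (2 * Real.pi)) / (1 - v ^ 2))
      = ((∫ v in Ioo (lowStart / x) (1 - boxHalfWidth / x), Real.log v / (1 - v ^ 2)) +
         ∫ v in Ioo (lowStart / x) (1 - boxHalfWidth / x), Real.log (x / (2 * Real.pi)) / (1 - v ^ 2)) +
        ((∫ v in Ioi (1 + boxHalfWidth / x), Real.log v / (1 - v ^ 2)) +
         ∫ v in Ioi (1 + boxHalfWidth / x), Real.log (x / (2 * Real.pi)) / (1 - v ^ 2)) := by rw [h_Ioo_add, h_Ioi_add]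
    _ = ((∫ v in Ioo (lowStart / x) (1 - boxHalfWidth / x), Real.log v / (1 - v ^ 2)) +
         ∫ v in Ioi (1 + boxHalfWidth / x), Real.log v / (1 - v ^ 2)) +
        (Real.log (x / (2 * Real.pi)) * (∫ v in Ioo (lowStart / x) (1 - boxHalfWidth / x), 1 / (1 - v ^ 2)) +
         Real.log (x / (2 * Real.pi)) * ∫ v in Ioi (1 + boxHalfWidth / x), 1 / (1 - v ^ 2)) := by rw [h_const_Ioo, h_const_Ioi]; ring
    _ = ((∫ v in Ioo (lowStart / x) (1 - boxHalfWidth / x), Real.log v / (1 - v ^ 2)) +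
         ∫ v in Ioi (1 + boxHalfWidth / x), Real.log v / (1 - v ^ 2)) +
        Real.log (x / (2 * Real.pi)) * ((∫ v in Ioo (lowStart / x) (1 - boxHalfWidth / x), 1 / (1 - v ^ 2)) +
         ∫ v in Ioi (1 + boxHalfWidth / x), 1 / (1 - v ^ 2)) := by ring

end Summit.RiemannHypothesis.RiemannHypothesis.Cruxes.Remainder0Xi.Rho2V2
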